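import Summits.QuantumFields.YangMills.Theorems.UnitScaleTiltFluctuationComparisonRegPrRestrictedLower
import Summits.QuantumFields.YangMills.Theorems.UnitScaleTiltFluctuationComparisonRegPrRestrictedUpperStep
import HarnessLib

/-!
# Route `UnitScaleTilt` — crux `FluctuationComparisonRegPrL` (stmt-QuantumFields-19935), STUB 3′ `stub_alphaTwoRunOfLane`, ADAPTER CONJUNCT
# `RepAtHeights` FOR THE CANONICAL v2 DATUM, PART 4: THE TWO-SIDED TRIVIAL-HISTORY SANDWICH OF THE RESTRICTED HEIGHT DENSITY (Bałaban's (41) ∧ (47)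
# for the small-field term, modulo the (α) rows, carrying the lane's trivial-history mass on the upper side), its log form, and
# `RepAtHeights (dataT3c …) 𝔠.b₀ 𝔠.p₀ ε₀` MODULO THE ONE LOCATED RESIDUAL «trivial-history mass ≤ 1» (support file `--supports stmt-QuantumFields-19935`)

Fleet lead `ym-ust-19201-p1` (gen 4).  Parts 1–3: `…RestrictedLowerStep` (one-step lower envelope from `fibre57Low`), `…RestrictedLower` ((47) for the
restricted density, lower log form), `…RestrictedUpperStep` (one-step upper envelope from `fibre49` with the mass `m_j(triv)`).

* §10 `dataT3c_restricted_sandwich` — for `n ≤ K`, a.e. on the window `PlaqSmall (θBal n)`, with `k = K − n`, `W = fieldShift V`: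
  `e^{−Ecst_k − Rm_k}·low_k(W) ≤ heightDensity F γ _ (histGood … K n) V ≤ e^{−Ecst_k + Rm_k}·m_k(triv, W)·low_k(W)` — (41) ∧ (47) p.266–267 for the term
  WITHOUT large fields of the route's `blockAvg ℰp` tower (frame `LogComparisonSmallFieldEnvelope.heightDensity_sandwich_of_oneStep`; bases from the
  delivered `Ineq47AE`/`Ineq41AE` at `j = 0`, `LF_0 = exp`, `m_0 = 1`).
* §11 `dataT3c_repAtHeights_upper_of_id` / `…_upper` (`n < K`) / `…_upper_top` (`n = K`) — the (41)-direction in log form: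
  `log ρ(V) + β_K·minActionRegPr F n K _ ε₀ V − D.PintH K n V + D.EcstH K n ≤ D.RmH K n + log m_{K−n}(triv, fieldShift V)`.
* §12 `dataT3c_repAtHeights_of_trivMass_le_one` — **`RepAtHeights (h.dataT3c hc γ hγ hγ1 π) 𝔠.b₀ 𝔠.p₀ ε₀` FROM THE (α) ROWS, the adapter's
  thresholds at every height (`θBal(n) ≤ a₁`, `B₃θBal(n) ≤ ε₀`, `4θBal(n) < ε₀`, `ε₀ ≤ a₀`), AND THE ONE RESIDUAL `∀ K j W, m_j(triv, W) ≤ 1`** — the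
  trivial-history mass of the lane's AC tower is the floored iterated Radon–Nikodym Jacobian of the averaging (`MassesAC`: `m_{j+1}(triv) =
  max 1 (T_j[m_j(triv)])`, `stepWeight_triv = 1`); it is `1` exactly when the averaging is Haar-compatible step by step (`T_j[1] ≤ 1`), which for the
  pinned `blockAvg ℰp` is NOT in the tree (only `haarAC_blockAvg`) — the located-unprinted exact-Haar point (fleet finding af2a5b6fdc02c5ee, F-α1-1).
  So the upper half of this adapter conjunct is EXACTLY as open as that point, and no more.
CONDITIONAL on the (α) rows; nothing of [Balaban1985UV3]/[Balaban1985Variational] is asserted.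

References: T. Bałaban, Commun. Math. Phys. 102 (1985) 255–275 [Balaban1985UV3] ((1)–(2) p.256, (41)–(42) p.266, (47) p.267, p.272 L32–33, Thm 2 p.272);
Commun. Math. Phys. 102 (1985) 277–309 [Balaban1985Variational] ((2), (6) p.278, Thm 1 (8) p.279); Commun. Math. Phys. 98 (1985) 17–51
[Balaban1985Averaging] ((10) p.19).
-/

set_option autoImplicit false

noncomputable section

namespace Summit.QuantumFields.YangMills.Theorems.RepAtHeightsAdapter

open MeasureTheory Filter
open Literature.MathematicalPhysics.QuantumFieldTheory.Balaban1983to89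
open Literature.MathematicalPhysics.QuantumFieldTheory.Balaban1983to89.B10 (TowerRun Ineq41 Ineq47)
open Literature.MathematicalPhysics.QuantumFieldTheory.Balaban1983to89.B10SectAGathering (StepPieces StepLeaves)
open Literature.MathematicalPhysics.QuantumFieldTheory.Balaban1983to89.AveragingRT (rnTransport)
open Literature.MathematicalPhysics.QuantumFieldTheory.Balaban1983to89.T3ContinuumYM3Torus
open Literature.MathematicalPhysics.QuantumFieldTheory.Balaban1983to89.T3UnitLawDensityEML (ℰp measurableE_ℰp measurable_blockAvg haarAC_blockAvg rt)
open Literature.MathematicalPhysics.QuantumFieldTheory.Balaban1983to89.T3UnitScaleTilt (θBal histGood measurableSet_plaqSmall)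
open Literature.MathematicalPhysics.QuantumFieldTheory.Balaban1983to89.T3LevelShift (fieldShift)
open Literature.MathematicalPhysics.QuantumFieldTheory.Balaban1983to89.T3RestrictedUnitDensity (towerDensity resDensity towerDensity_succ integrable_resDensity resDensity_nonneg)
open Literature.MathematicalPhysics.QuantumFieldTheory.Balaban1983to89.T3TiltDescent (heightDensity)
open Literature.MathematicalPhysics.QuantumFieldTheory.Balaban1983to89.T3AlphaInputsAC
open Literature.MathematicalPhysics.QuantumFieldTheory.Balaban1983to89.T3PrintedRegularMinimiser (regFibrePr minActionRegPr RegPr)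
open Literature.MathematicalPhysics.QuantumFieldTheory.Balaban1983to89.T3AvgDivergenceSplit (regPr_of_plaqSmall)
open Literature.MathematicalPhysics.QuantumFieldTheory.Balaban1983to89.T3CruxEstimates (plaqSmall_fieldShift)
open Literature.MathematicalPhysics.QuantumFieldTheory.Balaban1983to89.T3LogComparisonSocket (TwoSidedRepAt)
open Literature.MathematicalPhysics.QuantumFieldTheory.Balaban1983to89.Missing (boltzmann)
open Literature.MathematicalPhysics.QuantumFieldTheory.Balaban1985CMP102
open Literature.MathematicalPhysics.QuantumFieldTheory.Balaban1985CMP102.Setting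
open Summit.QuantumFields.Balaban3D.Carriers
open Summit.QuantumFields.Balaban3D.Proofs.Primitives
open Summit.QuantumFields.Balaban3D.Proofs.ScalesArithmetic (gk_pos gk_le_one)
open Summit.QuantumFields.Balaban3D.Proofs.TowerAC
open Summit.QuantumFields.Balaban3D.Proofs.StandardAC
open Summit.QuantumFields.Balaban3D.Proofs.StandardAC (one_le_stdTowerInputAC_mass_triv)
open Summit.QuantumFields.Balaban3D.Proofs.InputsAC
open Summit.QuantumFields.Balaban3D.Proofs.AlphaAC
open Summit.QuantumFields.Balaban3D.Proofs.Bound55AC (hint_stdAC)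
open Summit.QuantumFields.Balaban3D.Proofs.Bound55Masses (chiB chiB_nonneg chiB_le_one measurable_chiB measurable_stepWeight)
open Summit.QuantumFields.Balaban3D.Proofs.MassesAC (transport_le_massRecAC_ae)
open Summit.QuantumFields.Balaban3D.Proofs.Thm2AC
open Summit.QuantumFields.YangMills.Theorems.LogComparisonSmallFieldRecursion
open Summit.QuantumFields.YangMills.Theorems.LogComparisonSmallFieldEnvelope

/-! ## §10 The two-sided trivial-history sandwich of the restricted height density -/

section Sandwich

variable {F : T3Family} {𝔠 : AlphaConsts F.L (suGroupModel 2).N} {a₀ a₁ : ℝ}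
  (h : AlphaInputsT3AC.OfV2At F 𝔠 a₀ a₁) (hc : 0 < a₀ ∧ 0 < a₁ ∧ 𝔠.B₃ * a₁ ≤ a₀) (γ : ℝ) (hγ : 0 < γ)
  (hγ1 : γ ≤ (min 𝔠.gamma0 1) ^ 2) (π : AlphaInputsT3AC.PolymerT3 F)

/-- **THE UPPER ENVELOPES ARE INTEGRABLE**: `u_j = e^{−Ecst_j + Rm_j}·m_j(triv)·low_j` is dominated by `e^{−Ecst_j + Rm_j}·up_j` (the trivial history is
ONE summand of the (41) majorant: `TowerAC.mass_mul_exp_le_lfAC`, `Zterm_j(triv) = 0`, `χ_j ≤ 1`) and `up_j` is integrable at every `j ≤ K`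
(`dataT3c_integrable_up`). [cite: Balaban1985UV3, (41) p.266] -/
theorem dataT3c_integrable_upper (K j : ℕ) (hj : j ≤ K) :
    Integrable (fun W' : GaugeField (F.P K) j (Matrix.specialUnitaryGroup (Fin 2) ℂ) =>
      Real.exp (-((h.dataT3c hc γ hγ hγ1 π).Ecst K j) + (h.dataT3c hc γ hγ hγ1 π).Rm K j) *
        ((inputOfAC 𝔠.lane (h.pkgAtV2 hc γ hγ hγ1 K).X (h.pkgAtV2 hc γ hγ hγ1 K).𝔖).W.mass j (Hist.triv (F.P K) j) W' *
          (h.dataT3c hc γ hγ hγ1 π).low K j W'))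
      (fieldMeasure (F.P K) j (Matrix.specialUnitaryGroup (Fin 2) ℂ)) := by
  have hχ := h.dataT3c_chiRange hc γ hγ hγ1 π
  have hup := (h.dataT3c_integrable_up hc γ hγ hγ1 π K j hj).const_mul
    (Real.exp (-((h.dataT3c hc γ hγ hγ1 π).Ecst K j) + (h.dataT3c hc γ hγ hγ1 π).Rm K j))
  have hlow := h.dataT3c_integrable_low hc γ hγ hγ1 π K j hj
  have hM : Measurable fun W' : GaugeField (F.P K) j (Matrix.specialUnitaryGroup (Fin 2) ℂ) =>
      (inputOfAC 𝔠.lane (h.pkgAtV2 hc γ hγ hγ1 K).X (h.pkgAtV2 hc γ hγ hγ1 K).𝔖).W.mass j (Hist.triv (F.P K) j) W' :=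
    stdTowerInputAC_mass_measurable (h.pkgAtV2 hc γ hγ hγ1 K).toPkgAt.X 𝔠.lane.carrier (h.pkgAtV2 hc γ hγ hγ1 K).𝔖 j (Hist.triv (F.P K) j)
  refine hup.mono' ((hM.aestronglyMeasurable.mul hlow.aestronglyMeasurable).const_mul _) (ae_of_all _ fun W' => ?_)
  have h0M := (inputOfAC 𝔠.lane (h.pkgAtV2 hc γ hγ hγ1 K).X (h.pkgAtV2 hc γ hγ hγ1 K).𝔖).W.mass_nonneg j (Hist.triv (F.P K) j) W'
  have h0l := low_nonneg hχ K j W'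
  rw [Real.norm_eq_abs, abs_of_nonneg (mul_nonneg (Real.exp_nonneg _) (mul_nonneg h0M h0l))]
  refine mul_le_mul_of_nonneg_left ?_ (Real.exp_nonneg _)
  -- `m_j(triv)·low_j ≤ m_j(triv)·exp(−mainT(triv) + Pint(triv) + Zterm(triv)) ≤ up_j`
  have hZ : (h.dataT3c hc γ hγ hγ1 π).Zterm K j ((h.dataT3c hc γ hγ hγ1 π).triv K j) = 0 := (h.pkgAtV2 hc γ hγ hγ1 K).T.Zterm_triv j
  have h1 : (h.dataT3c hc γ hγ hγ1 π).low K j W' ≤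
      Real.exp (-((h.dataT3c hc γ hγ hγ1 π).mainT K j ((h.dataT3c hc γ hγ hγ1 π).triv K j) W')
        + (h.dataT3c hc γ hγ hγ1 π).Pint K j ((h.dataT3c hc γ hγ hγ1 π).triv K j) W'
        + (h.dataT3c hc γ hγ hγ1 π).Zterm K j ((h.dataT3c hc γ hγ hγ1 π).triv K j)) := by
    rw [hZ, add_zero]
    exact mul_le_of_le_one_left (Real.exp_nonneg _) (hχ K j W').2
  refine (mul_le_mul_of_nonneg_left h1 h0M).trans ?_
  exact mass_mul_exp_le_lfAC _ j (Hist.triv (F.P K) j) W'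
    (fun hh => -((h.dataT3c hc γ hγ hγ1 π).mainT K j hh W') + (h.dataT3c hc γ hγ hγ1 π).Pint K j hh W' + (h.dataT3c hc γ hγ hγ1 π).Zterm K j hh)

/-- **(41) ∧ (47) AT THE TRIVIAL HISTORY FOR THE RESTRICTED HEIGHT DENSITY OF THE v2 DATUM** (modulo the (α) rows; the upper side carries the lane's
trivial-history mass): for every run `K` and comparison height `n ≤ K`, with `k = K − n` and `W = fieldShift V`, almost everywhere on the window
`PlaqSmall (θBal n)`: `e^{−Ecst_k − Rm_k}·low_k(W) ≤ heightDensity F γ _ (histGood … K n) V ≤ e^{−Ecst_k + Rm_k}·m_k(triv, W)·low_k(W)` — the frame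
`heightDensity_sandwich_of_oneStep` with the one-step envelopes of Parts 1 and 3 (`dataT3c_oneStep_lower`, `dataT3c_oneStep_upper`) and the bases
`Ineq47AE`/`Ineq41AE` at `j = 0` (`LF_0[Φ] = exp Φ(triv)`, `m_0 = 1`, `Zterm_0(triv) = 0`, `χ_0 = 1` on the window). [cite: Balaban1985UV3, (41) p.266 + (47) p.267 + p.272 L32–33] -/
theorem dataT3c_restricted_sandwich (K n : ℕ) (hK : n ≤ K) :
    ∀ᵐ V ∂fieldMeasure (F.P n) 0 (Matrix.specialUnitaryGroup (Fin 2) ℂ), PlaqSmall (θBal F.L γ 𝔠.b₀ 𝔠.p₀ n) V →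
      Real.exp (-((h.dataT3c hc γ hγ hγ1 π).Ecst K (K - n)) - (h.dataT3c hc γ hγ hγ1 π).Rm K (K - n)) *
            (h.dataT3c hc γ hγ hγ1 π).low K (K - n)
              (fieldShift (F.sitesPerDir_eq (m := F.m) (K := K) (j := K - n) (m' := F.m) (K' := n) (j' := 0) (by omega)) V) ≤
          heightDensity F γ hK (histGood F ℰp (θBal F.L γ 𝔠.b₀ 𝔠.p₀) K n) V ∧
        heightDensity F γ hK (histGood F ℰp (θBal F.L γ 𝔠.b₀ 𝔠.p₀) K n) V ≤
          Real.exp (-((h.dataT3c hc γ hγ hγ1 π).Ecst K (K - n)) + (h.dataT3c hc γ hγ hγ1 π).Rm K (K - n)) *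
            ((inputOfAC 𝔠.lane (h.pkgAtV2 hc γ hγ hγ1 K).X (h.pkgAtV2 hc γ hγ hγ1 K).𝔖).W.mass (K - n) (Hist.triv (F.P K) (K - n))
                (fieldShift (F.sitesPerDir_eq (m := F.m) (K := K) (j := K - n) (m' := F.m) (K' := n) (j' := 0) (by omega)) V) *
              (h.dataT3c hc γ hγ hγ1 π).low K (K - n)
                (fieldShift (F.sitesPerDir_eq (m := F.m) (K := K) (j := K - n) (m' := F.m) (K' := n) (j' := 0) (by omega)) V)) := by
  have hres0 : ∀ W : GaugeField (F.P K) 0 (Matrix.specialUnitaryGroup (Fin 2) ℂ),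
      resDensity F γ K Set.univ 0 W = boltzmann (F.P K) ((F.scheme ℰp γ).β K) W := fun W => by
    show Set.univ.indicator _ W = _
    rw [Set.indicator_univ]
  -- the (41) majorant at `j = 0` is the bare exponential: one history, `LF_0[Φ] = exp Φ(triv)`
  have hup0 : ∀ W : GaugeField (F.P K) 0 (Matrix.specialUnitaryGroup (Fin 2) ℂ), (h.dataT3c hc γ hγ hγ1 π).up K 0 W =
      Real.exp (-((h.dataT3c hc γ hγ hγ1 π).mainT K 0 ((h.dataT3c hc γ hγ hγ1 π).triv K 0) W)
        + (h.dataT3c hc γ hγ hγ1 π).Pint K 0 ((h.dataT3c hc γ hγ hγ1 π).triv K 0) W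
        + (h.dataT3c hc γ hγ hγ1 π).Zterm K 0 ((h.dataT3c hc γ hγ hγ1 π).triv K 0)) := fun W =>
    (inputOfAC 𝔠.lane (h.pkgAtV2 hc γ hγ hγ1 K).X (h.pkgAtV2 hc γ hγ hγ1 K).𝔖).towerWith_lf_zero (fun _ => True) W
      (fun hh => -((h.dataT3c hc γ hγ hγ1 π).mainT K 0 hh W) + (h.dataT3c hc γ hγ hγ1 π).Pint K 0 hh W + (h.dataT3c hc γ hγ hγ1 π).Zterm K 0 hh)
  have hZ0 : (h.dataT3c hc γ hγ hγ1 π).Zterm K 0 ((h.dataT3c hc γ hγ hγ1 π).triv K 0) = 0 := (h.pkgAtV2 hc γ hγ hγ1 K).T.Zterm_triv 0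
  have hM0 : ∀ W : GaugeField (F.P K) 0 (Matrix.specialUnitaryGroup (Fin 2) ℂ),
      (inputOfAC 𝔠.lane (h.pkgAtV2 hc γ hγ hγ1 K).X (h.pkgAtV2 hc γ hγ hγ1 K).𝔖).W.mass 0 (Hist.triv (F.P K) 0) W = 1 := fun W =>
    (inputOfAC 𝔠.lane (h.pkgAtV2 hc γ hγ hγ1 K).X (h.pkgAtV2 hc γ hγ hγ1 K).𝔖).W.mass_zero _ W
  have hbase : ∀ᵐ W ∂fieldMeasure (F.P K) 0 (Matrix.specialUnitaryGroup (Fin 2) ℂ), PlaqSmall (θBal F.L γ 𝔠.b₀ 𝔠.p₀ K) W →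
      (fun (j : ℕ) (W' : GaugeField (F.P K) j (Matrix.specialUnitaryGroup (Fin 2) ℂ)) =>
          Real.exp (-((h.dataT3c hc γ hγ hγ1 π).Ecst K j) - (h.dataT3c hc γ hγ hγ1 π).Rm K j) * (h.dataT3c hc γ hγ hγ1 π).low K j W') 0 W ≤
          boltzmann (F.P K) ((F.scheme ℰp γ).β K) W ∧
        boltzmann (F.P K) ((F.scheme ℰp γ).β K) W ≤
          (fun (j : ℕ) (W' : GaugeField (F.P K) j (Matrix.specialUnitaryGroup (Fin 2) ℂ)) =>
            Real.exp (-((h.dataT3c hc γ hγ hγ1 π).Ecst K j) + (h.dataT3c hc γ hγ hγ1 π).Rm K j) *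
              ((inputOfAC 𝔠.lane (h.pkgAtV2 hc γ hγ hγ1 K).X (h.pkgAtV2 hc γ hγ hγ1 K).𝔖).W.mass j (Hist.triv (F.P K) j) W' *
                (h.dataT3c hc γ hγ hγ1 π).low K j W')) 0 W := by
    filter_upwards [h.dataT3c_ineq47AE hc γ hγ hγ1 π K 0 (Nat.zero_le K), h.dataT3c_ineq41AE hc γ hγ hγ1 π K 0 (Nat.zero_le K)]
      with W h47 h41 hs
    refine ⟨by rw [← hres0 W]; exact h47, ?_⟩
    have hχ : (h.dataT3c hc γ hγ hγ1 π).χ K 0 W = 1 := by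
      rw [h.dataT3c_chi_eq hc γ hγ hγ1 π K 0 (Nat.zero_le K)]
      unfold chiSmall
      exact if_pos (show PlaqSmallOn Set.univ (θBal F.L γ 𝔠.b₀ 𝔠.p₀ (K - 0)) W from fun q _ => hs q)
    have hlow : (h.dataT3c hc γ hγ hγ1 π).up K 0 W = (h.dataT3c hc γ hγ hγ1 π).low K 0 W := by
      rw [hup0 W, hZ0, add_zero]
      show _ = (h.dataT3c hc γ hγ hγ1 π).χ K 0 W * _
      rw [hχ, one_mul]
    rw [← hres0 W]
    refine h41.trans (le_of_eq ?_)
    show _ = _ * (_ * _)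
    rw [hM0 W, one_mul, hlow]
  have hstep : ∀ (j : ℕ) (hj : j + 1 ≤ K - n), ∀ᵐ W ∂fieldMeasure (F.P K) (j + 1) (Matrix.specialUnitaryGroup (Fin 2) ℂ),
      PlaqSmall (θBal F.L γ 𝔠.b₀ 𝔠.p₀ (K - (j + 1))) W →
        (fun (j : ℕ) (W' : GaugeField (F.P K) j (Matrix.specialUnitaryGroup (Fin 2) ℂ)) =>
            Real.exp (-((h.dataT3c hc γ hγ hγ1 π).Ecst K j) - (h.dataT3c hc γ hγ hγ1 π).Rm K j) * (h.dataT3c hc γ hγ hγ1 π).low K j W')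
            (j + 1) W ≤
          (rt F K j (by omega)).T ({W' | PlaqSmall (θBal F.L γ 𝔠.b₀ 𝔠.p₀ (K - j)) W'}.indicator
            ((fun (j : ℕ) (W' : GaugeField (F.P K) j (Matrix.specialUnitaryGroup (Fin 2) ℂ)) =>
              Real.exp (-((h.dataT3c hc γ hγ hγ1 π).Ecst K j) - (h.dataT3c hc γ hγ hγ1 π).Rm K j) * (h.dataT3c hc γ hγ hγ1 π).low K j W') j)) W ∧
        (rt F K j (by omega)).T ({W' | PlaqSmall (θBal F.L γ 𝔠.b₀ 𝔠.p₀ (K - j)) W'}.indicator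
            ((fun (j : ℕ) (W' : GaugeField (F.P K) j (Matrix.specialUnitaryGroup (Fin 2) ℂ)) =>
              Real.exp (-((h.dataT3c hc γ hγ hγ1 π).Ecst K j) + (h.dataT3c hc γ hγ hγ1 π).Rm K j) *
                ((inputOfAC 𝔠.lane (h.pkgAtV2 hc γ hγ hγ1 K).X (h.pkgAtV2 hc γ hγ hγ1 K).𝔖).W.mass j (Hist.triv (F.P K) j) W' *
                  (h.dataT3c hc γ hγ hγ1 π).low K j W')) j)) W ≤
          (fun (j : ℕ) (W' : GaugeField (F.P K) j (Matrix.specialUnitaryGroup (Fin 2) ℂ)) =>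
            Real.exp (-((h.dataT3c hc γ hγ hγ1 π).Ecst K j) + (h.dataT3c hc γ hγ hγ1 π).Rm K j) *
              ((inputOfAC 𝔠.lane (h.pkgAtV2 hc γ hγ hγ1 K).X (h.pkgAtV2 hc γ hγ hγ1 K).𝔖).W.mass j (Hist.triv (F.P K) j) W' *
                (h.dataT3c hc γ hγ hγ1 π).low K j W')) (j + 1) W := by
    intro j hj
    filter_upwards [dataT3c_oneStep_lower h hc γ hγ hγ1 π K j (by omega), dataT3c_oneStep_upper h hc γ hγ hγ1 π K j (by omega)]
      with W h1 h2 hs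
    exact ⟨h1, h2 hs⟩
  exact heightDensity_sandwich_of_oneStep F hγ.le K (θBal F.L γ 𝔠.b₀ 𝔠.p₀)
    (fun (j : ℕ) (W' : GaugeField (F.P K) j (Matrix.specialUnitaryGroup (Fin 2) ℂ)) =>
      Real.exp (-((h.dataT3c hc γ hγ hγ1 π).Ecst K j) - (h.dataT3c hc γ hγ hγ1 π).Rm K j) * (h.dataT3c hc γ hγ hγ1 π).low K j W')
    (fun (j : ℕ) (W' : GaugeField (F.P K) j (Matrix.specialUnitaryGroup (Fin 2) ℂ)) =>
      Real.exp (-((h.dataT3c hc γ hγ hγ1 π).Ecst K j) + (h.dataT3c hc γ hγ hγ1 π).Rm K j) *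
        ((inputOfAC 𝔠.lane (h.pkgAtV2 hc γ hγ hγ1 K).X (h.pkgAtV2 hc γ hγ hγ1 K).𝔖).W.mass j (Hist.triv (F.P K) j) W' *
          (h.dataT3c hc γ hγ hγ1 π).low K j W')) hK
    (fun j hj => (h.dataT3c_integrable_low hc γ hγ hγ1 π K j (by omega)).const_mul _)
    (fun j hj => dataT3c_integrable_upper h hc γ hγ hγ1 π K j (by omega)) hbase hstep

end Sandwich

/-! ## §11 The (41)-direction of `RepAtHeights`'s a.e. clause in log form, with the trivial-history mass -/

section UpperLog

variable {F : T3Family} {𝔠 : AlphaConsts F.L (suGroupModel 2).N} {a₀ a₁ : ℝ}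
  (h : AlphaInputsT3AC.OfV2At F 𝔠 a₀ a₁) (hc : 0 < a₀ ∧ 0 < a₁ ∧ 𝔠.B₃ * a₁ ≤ a₀) (γ : ℝ) (hγ : 0 < γ)
  (hγ1 : γ ≤ (min 𝔠.gamma0 1) ^ 2) (π : AlphaInputsT3AC.PolymerT3 F)

/-- **THE UPPER HALF OF THE TWO-SIDED REPRESENTATION, LOG FORM, WITH THE MASS, GIVEN THE IDENTIFICATION OF THE MAIN TERM** (`hid` as in
`dataT3c_repAtHeights_lower_of_id`): a.e. on the window,
`log ρ(V) + β_K·minActionRegPr F n K _ ε₀ V − D.PintH K n V + D.EcstH K n ≤ D.RmH K n + log m_{K−n}(triv, fieldShift V)` — (41) at the trivial history for the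
restricted density (`dataT3c_restricted_sandwich`), `χ = 1` on the window, `MainTermIsAction`, `PintH_of_le`; the mass is `≥ 1`
(`one_le_stdTowerInputAC_mass_triv`), so its logarithm is the honest non-negative excess over `RepAtHeights`'s typed bound. [cite: Balaban1985UV3, (41) p.266] -/
theorem dataT3c_repAtHeights_upper_of_id (K n : ℕ) (hK : n ≤ K) (ε₀ : ℝ)
    (hid : ∀ V : GaugeField (F.P n) 0 (Matrix.specialUnitaryGroup (Fin 2) ℂ), PlaqSmall (θBal F.L γ 𝔠.b₀ 𝔠.p₀ n) V →
      wilsonAction4 ((h.dataT3c hc γ hγ hγ1 π).Umin K (K - n) ((h.dataT3c hc γ hγ hγ1 π).triv K (K - n))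
        (fieldShift (F.sitesPerDir_eq (m := F.m) (K := K) (j := K - n) (m' := F.m) (K' := n) (j' := 0) (by omega)) V)) =
        minActionRegPr F n K hK ε₀ V) :
    ∀ᵐ V ∂fieldMeasure (F.P n) 0 (Matrix.specialUnitaryGroup (Fin 2) ℂ), PlaqSmall (θBal F.L γ 𝔠.b₀ 𝔠.p₀ n) V →
      Real.log (heightDensity F γ hK (histGood F ℰp (θBal F.L γ 𝔠.b₀ 𝔠.p₀) K n) V) +
          (F.scheme ℰp γ).β K * minActionRegPr F n K hK ε₀ V - (h.dataT3c hc γ hγ hγ1 π).PintH K n V +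
            (h.dataT3c hc γ hγ hγ1 π).EcstH K n ≤
        (h.dataT3c hc γ hγ hγ1 π).RmH K n +
          Real.log ((inputOfAC 𝔠.lane (h.pkgAtV2 hc γ hγ hγ1 K).X (h.pkgAtV2 hc γ hγ hγ1 K).𝔖).W.mass (K - n) (Hist.triv (F.P K) (K - n))
            (fieldShift (F.sitesPerDir_eq (m := F.m) (K := K) (j := K - n) (m' := F.m) (K' := n) (j' := 0) (by omega)) V)) := by
  have hup := F.sitesPerDir_eq (m := F.m) (K := K) (j := K - n) (m' := F.m) (K' := n) (j' := 0) (by omega)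
  filter_upwards [dataT3c_restricted_sandwich h hc γ hγ hγ1 π K n hK] with V hV hs
  obtain ⟨hlow, hupp⟩ := hV hs
  have hsW : PlaqSmall (θBal F.L γ 𝔠.b₀ 𝔠.p₀ (K - (K - n))) (fieldShift hup V) := by
    rw [Nat.sub_sub_self hK]
    exact (plaqSmall_fieldShift F hup _ V).mpr hs
  have hχ : (h.dataT3c hc γ hγ hγ1 π).χ K (K - n) (fieldShift hup V) = 1 := by
    rw [h.dataT3c_chi_eq hc γ hγ hγ1 π K (K - n) (by omega)]
    unfold chiSmall
    exact if_pos (show PlaqSmallOn Set.univ (θBal F.L γ 𝔠.b₀ 𝔠.p₀ (K - (K - n))) (fieldShift hup V) from fun q _ => hsW q)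
  have hmain : (h.dataT3c hc γ hγ hγ1 π).mainT K (K - n) ((h.dataT3c hc γ hγ hγ1 π).triv K (K - n)) (fieldShift hup V) =
      (F.scheme ℰp γ).β K * minActionRegPr F n K hK ε₀ V := by
    rw [h.dataT3c_mainTermIsAction hc γ hγ hγ1 π K (K - n) _ (fieldShift hup V), hid V hs]
  have hPint : (h.dataT3c hc γ hγ hγ1 π).Pint K (K - n) ((h.dataT3c hc γ hγ hγ1 π).triv K (K - n)) (fieldShift hup V) =
      (h.dataT3c hc γ hγ hγ1 π).PintH K n V := ((h.dataT3c hc γ hγ hγ1 π).PintH_of_le hK V).symm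
  have hlowW : (h.dataT3c hc γ hγ hγ1 π).low K (K - n) (fieldShift hup V) =
      Real.exp (-((F.scheme ℰp γ).β K * minActionRegPr F n K hK ε₀ V) + (h.dataT3c hc γ hγ hγ1 π).PintH K n V) := by
    show (h.dataT3c hc γ hγ hγ1 π).χ K (K - n) (fieldShift hup V) * Real.exp _ = _
    rw [hχ, one_mul, hmain, hPint]
  rw [hlowW] at hlow hupp
  have hpos : 0 < heightDensity F γ hK (histGood F ℰp (θBal F.L γ 𝔠.b₀ 𝔠.p₀) K n) V :=
    lt_of_lt_of_le (mul_pos (Real.exp_pos _) (Real.exp_pos _)) hlow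
  have hM : 1 ≤ (inputOfAC 𝔠.lane (h.pkgAtV2 hc γ hγ hγ1 K).X (h.pkgAtV2 hc γ hγ hγ1 K).𝔖).W.mass (K - n) (Hist.triv (F.P K) (K - n))
      (fieldShift hup V) :=
    one_le_stdTowerInputAC_mass_triv (h.pkgAtV2 hc γ hγ hγ1 K).toPkgAt.X 𝔠.lane.carrier (h.pkgAtV2 hc γ hγ hγ1 K).𝔖 (K - n) _
  have hMpos : 0 < (inputOfAC 𝔠.lane (h.pkgAtV2 hc γ hγ hγ1 K).X (h.pkgAtV2 hc γ hγ hγ1 K).𝔖).W.mass (K - n) (Hist.triv (F.P K) (K - n))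
      (fieldShift hup V) := lt_of_lt_of_le one_pos hM
  have hlog := Real.log_le_log hpos hupp
  rw [Real.log_mul (Real.exp_pos _).ne' (mul_pos hMpos (Real.exp_pos _)).ne', Real.log_mul hMpos.ne' (Real.exp_pos _).ne',
    Real.log_exp, Real.log_exp] at hlog
  show _ ≤ (h.dataT3c hc γ hγ hγ1 π).Rm K (K - n) + _
  have hE : (h.dataT3c hc γ hγ hγ1 π).EcstH K n = (h.dataT3c hc γ hγ hγ1 π).Ecst K (K - n) := rfl
  rw [hE]
  linarith

/-- **BELOW THE CUT-OFF (`n < K`)**, under the adapter's thresholds: the (41)-direction with the mass (`dataT3c_uminTriv` identifies the main term).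
[cite: Balaban1985UV3, (41) p.266; Balaban1985Variational, Thm 1 (8) p.279] -/
theorem dataT3c_repAtHeights_upper (K n : ℕ) (hnK : n < K) (ε₀ : ℝ)
    (ha₁ : θBal F.L γ 𝔠.b₀ 𝔠.p₀ n ≤ a₁) (hlo : 𝔠.B₃ * θBal F.L γ 𝔠.b₀ 𝔠.p₀ n ≤ ε₀) (hhi : ε₀ ≤ a₀) :
    ∀ᵐ V ∂fieldMeasure (F.P n) 0 (Matrix.specialUnitaryGroup (Fin 2) ℂ), PlaqSmall (θBal F.L γ 𝔠.b₀ 𝔠.p₀ n) V →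
      Real.log (heightDensity F γ hnK.le (histGood F ℰp (θBal F.L γ 𝔠.b₀ 𝔠.p₀) K n) V) +
          (F.scheme ℰp γ).β K * minActionRegPr F n K hnK.le ε₀ V - (h.dataT3c hc γ hγ hγ1 π).PintH K n V +
            (h.dataT3c hc γ hγ hγ1 π).EcstH K n ≤
        (h.dataT3c hc γ hγ hγ1 π).RmH K n +
          Real.log ((inputOfAC 𝔠.lane (h.pkgAtV2 hc γ hγ hγ1 K).X (h.pkgAtV2 hc γ hγ hγ1 K).𝔖).W.mass (K - n) (Hist.triv (F.P K) (K - n))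
            (fieldShift (F.sitesPerDir_eq (m := F.m) (K := K) (j := K - n) (m' := F.m) (K' := n) (j' := 0) (by omega)) V)) :=
  dataT3c_repAtHeights_upper_of_id h hc γ hγ hγ1 π K n hnK.le ε₀
    fun V hV => (h.dataT3c_uminTriv hc γ hγ hγ1 π K n hnK ε₀ ha₁ hlo hhi V hV).2

/-- **AT THE CUT-OFF (`n = K`)** (`U_0(V, triv) = V`, the regular fibre is `{V}`): the (41)-direction with the mass. [cite: Balaban1985UV3, (1) p.256 + (41) p.266] -/
theorem dataT3c_repAtHeights_upper_top (K : ℕ) (ε₀ : ℝ) (hε : θBal F.L γ 𝔠.b₀ 𝔠.p₀ K ≤ ε₀) (h4 : 4 * θBal F.L γ 𝔠.b₀ 𝔠.p₀ K < ε₀) :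
    ∀ᵐ V ∂fieldMeasure (F.P K) 0 (Matrix.specialUnitaryGroup (Fin 2) ℂ), PlaqSmall (θBal F.L γ 𝔠.b₀ 𝔠.p₀ K) V →
      Real.log (heightDensity F γ le_rfl (histGood F ℰp (θBal F.L γ 𝔠.b₀ 𝔠.p₀) K K) V) +
          (F.scheme ℰp γ).β K * minActionRegPr F K K le_rfl ε₀ V - (h.dataT3c hc γ hγ hγ1 π).PintH K K V +
            (h.dataT3c hc γ hγ hγ1 π).EcstH K K ≤
        (h.dataT3c hc γ hγ hγ1 π).RmH K K +
          Real.log ((inputOfAC 𝔠.lane (h.pkgAtV2 hc γ hγ hγ1 K).X (h.pkgAtV2 hc γ hγ hγ1 K).𝔖).W.mass (K - K) (Hist.triv (F.P K) (K - K))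
            (fieldShift (F.sitesPerDir_eq (m := F.m) (K := K) (j := K - K) (m' := F.m) (K' := K) (j' := 0) (by omega)) V)) := by
  refine dataT3c_repAtHeights_upper_of_id h hc γ hγ hγ1 π K K le_rfl ε₀ fun V hV => ?_
  have hreg : RegPr F K K ε₀ V := by
    refine regPr_of_plaqSmall F hV ?_ ?_
    · show θBal F.L γ 𝔠.b₀ 𝔠.p₀ K ≤ ε₀ * ((F.L : ℝ)⁻¹) ^ (2 * (K - K))
      rw [Nat.sub_self, mul_zero, pow_zero, mul_one]
      exact hε
    · rw [Nat.sub_self, mul_zero, pow_zero, mul_one]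
      exact h4
  rw [minActionRegPr_self_of_regPr K ε₀ V hreg]
  exact wilsonAction4_umin_triv_of_eq_zero h hc γ hγ hγ1 π K (Nat.sub_self K) _ V

end UpperLog

/-! ## §12 `RepAtHeights` for the v2 datum, modulo the one located residual «trivial-history mass ≤ 1» -/

section Assembly

variable {F : T3Family} {𝔠 : AlphaConsts F.L (suGroupModel 2).N} {a₀ a₁ : ℝ}
  (h : AlphaInputsT3AC.OfV2At F 𝔠 a₀ a₁) (hc : 0 < a₀ ∧ 0 < a₁ ∧ 𝔠.B₃ * a₁ ≤ a₀) (γ : ℝ) (hγ : 0 < γ)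
  (hγ1 : γ ≤ (min 𝔠.gamma0 1) ^ 2) (π : AlphaInputsT3AC.PolymerT3 F)

/-- **`RepAtHeights (dataT3c …) 𝔠.b₀ 𝔠.p₀ ε₀` FROM THE (α) ROWS, THE ADAPTER'S THRESHOLDS, AND THE ONE RESIDUAL «trivial-history mass ≤ 1»**:
if at every height `θBal(n) ≤ a₁`, `B₃θBal(n) ≤ ε₀`, `4θBal(n) < ε₀` (an adapter gets these from `T3ThresholdSmallness` once `γ ≤ γ₁(ε₀)`), `ε₀ ≤ a₀`,
and the trivial-history masses of the package's AC towers are `≤ 1` (⟺ `= 1`: the averaging loses no Haar mass on the small-field recursion — TRUE for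
an exactly Haar-compatible averaging, NOT in the tree for `blockAvg ℰp`: the located-unprinted exact-Haar point, finding F-α1-1), then the two-sided
representation `T3LogComparisonSocket.TwoSidedRepAt F γ 𝔠.b₀ 𝔠.p₀ ε₀ D.PintH D.EcstH D.RmH` holds for the v2 datum — [Balaban1985UV3] (41) ∧ (47) at the
trivial history for the RESTRICTED height densities of the route, read on the record's own p-function.  The `Rm`-clauses are unconditional
(`dataT3c_rmH_clauses`); the (47)-direction is unconditional given the thresholds (`dataT3c_repAtHeights_lower(_top)`); only the (41)-direction uses the
mass hypothesis. [cite: Balaban1985UV3, (41) p.266 + (47) p.267 + Thm 2 p.272] -/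
theorem dataT3c_repAtHeights_of_trivMass_le_one (ε₀ : ℝ) (hhi : ε₀ ≤ a₀)
    (hth : ∀ n : ℕ, θBal F.L γ 𝔠.b₀ 𝔠.p₀ n ≤ a₁ ∧ 𝔠.B₃ * θBal F.L γ 𝔠.b₀ 𝔠.p₀ n ≤ ε₀ ∧ 4 * θBal F.L γ 𝔠.b₀ 𝔠.p₀ n < ε₀)
    (hM : ∀ (K j : ℕ) (W : GaugeField (F.P K) j (Matrix.specialUnitaryGroup (Fin 2) ℂ)),
      (inputOfAC 𝔠.lane (h.pkgAtV2 hc γ hγ hγ1 K).X (h.pkgAtV2 hc γ hγ hγ1 K).𝔖).W.mass j (Hist.triv (F.P K) j) W ≤ 1) :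
    RepAtHeights (h.dataT3c hc γ hγ hγ1 π) 𝔠.b₀ 𝔠.p₀ ε₀ := by
  refine ⟨(dataT3c_rmH_clauses h hc γ hγ hγ1 π).1, (dataT3c_rmH_clauses h hc γ hγ hγ1 π).2, fun K n hK => ?_⟩
  have hθ0 : ∀ i, 0 < θBal F.L γ 𝔠.b₀ 𝔠.p₀ i := fun i =>
    T3MinimiserStabilityReduction.θBal_pos (le_of_lt F.hL.2) hγ (hγ1.trans (sq_min_one_le _ 𝔠.gamma0_pos)) 𝔠.b₀_pos 𝔠.p₀ i
  have hlogM : ∀ (j : ℕ) (W : GaugeField (F.P K) j (Matrix.specialUnitaryGroup (Fin 2) ℂ)),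
      Real.log ((inputOfAC 𝔠.lane (h.pkgAtV2 hc γ hγ hγ1 K).X (h.pkgAtV2 hc γ hγ hγ1 K).𝔖).W.mass j (Hist.triv (F.P K) j) W) ≤ 0 :=
    fun j W => Real.log_nonpos ((inputOfAC 𝔠.lane (h.pkgAtV2 hc γ hγ hγ1 K).X (h.pkgAtV2 hc γ hγ hγ1 K).𝔖).W.mass_nonneg j _ W) (hM K j W)
  rcases Nat.lt_or_ge n K with hlt | hge
  · filter_upwards [dataT3c_repAtHeights_lower h hc γ hγ hγ1 π K n hlt ε₀ (hth n).1 (hth n).2.1 hhi,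
      dataT3c_repAtHeights_upper h hc γ hγ hγ1 π K n hlt ε₀ (hth n).1 (hth n).2.1 hhi] with V hL hU hs _
    have h1 := (hL hs).2
    have h2 := hU hs
    rw [abs_le]
    exact ⟨h1, h2.trans (add_le_of_nonpos_right (hlogM _ _))⟩
  · obtain rfl : n = K := le_antisymm hK hge
    have hε : θBal F.L γ 𝔠.b₀ 𝔠.p₀ n ≤ ε₀ := by have := hθ0 n; have := (hth n).2.2; linarith
    filter_upwards [dataT3c_repAtHeights_lower_top h hc γ hγ hγ1 π n ε₀ hε (hth n).2.2,
      dataT3c_repAtHeights_upper_top h hc γ hγ hγ1 π n ε₀ hε (hth n).2.2] with V hL hU hs _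
    have h1 := (hL hs).2
    have h2 := hU hs
    rw [abs_le]
    exact ⟨h1, h2.trans (add_le_of_nonpos_right (hlogM _ _))⟩

end Assembly

end Summit.QuantumFields.YangMills.Theorems.RepAtHeightsAdapter

end
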